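import Summits.NavierStokesRegularity.NavierStokesRegularity.Theorems.TerminalTraceTypeITraceScarL3LayerDecayGaugeFree
import Literature.Analysis.FluidPDE.NSViscosityRescaling
import Literature.Analysis.FluidPDE.NSLerayHopfABCScaling

set_option linter.dupNamespace false

/-!
# The terminal-layer criterion of item 18385 (ROUND-33) at GENERAL VISCOSITY (seed s33-2)

Plate t34 of nsreg-p2 g30 and its pressure-free form (`isBackwardBoundedAt_of_terminalLayerDecay_unit`,
file `…LayerDecayGaugeFree.lean`) are stated at `ν = 1`.  This file transports them to viscosity
`ν > 0` by Tao's viscosity normalisation `v(s,x) = ν⁻¹ u(s/ν, x)` (blow-up time `νT`, classical at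
viscosity `1` by `IsClassicalNSSolutionOn.viscosityRescale_set`, Leray–Hopf by
`IsLerayHopfOn.viscosityRescale`, Type I in time with constant `C/√ν`, not backward bounded at
`(νT, x₀)` by `not_isBackwardBoundedAt_viscosityRescale`) — the template is the tree's
`not_memLp_three_of_logMean_lt_one` (T28-C at general `ν`).  The class transports as follows: the
one-sided Lipschitz companion `‖u(t,x)‖ − ‖u(t,y)‖ ≤ C_g·dist(y,x)/(T−t)` keeps its constant
(`‖v(s,x)‖ − ‖v(s,y)‖ ≤ C_g·dist(y,x)/(νT−s)`), and the terminal-layer dial at viscosity `ν` reads, with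
the PARABOLIC time lag `τ²l²/ν`,
«∀ ε > 0 ∃ τ ∈ (0,1] ∃ l₁ > 0 ∀ l ≤ l₁ ∀ x ∈ B(x₀,ρ): ∫_{B(x,l)} |u(T − τ²l²/ν)|² ≤ ε τ l»
(the factor `ν⁻²` produced by the amplitude is absorbed by `∀ ε`).

* `isBackwardBoundedAt_of_terminalLayerDecay` — (a) ∧ (b)_ν at `x₀` ⇒ `u` backward bounded at
  `(T,x₀)`, for classical Leray–Hopf Type-I (in time) solutions at viscosity `ν`;
* `typeITraceScarL3_of_terminalLayerDecay` — item 18385's binders VERBATIM (all `ν`) + class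
  (a) ∧ (b)_ν ⇒ the item's conclusion at `x₀`.  No pressure clause, no carried hypothesis.

WHAT THIS IS NOT: not a proof of 18385 (the dial (b)_ν is assumed and fails at singular points by the
plate's own floor), not a Type-I exclusion, NOT Navier–Stokes regularity.
-/

noncomputable section

open MeasureTheory Set Function Metric Filter Topology Literature.Analysis.FluidPDE
open scoped ENNReal NNReal

namespace Summit.NavierStokesRegularity.NavierStokesRegularity.Theorems.TypeITraceScarL3

/-- **The terminal-layer criterion at viscosity `ν > 0`, backward-boundedness form.**  For a
classical solution `(u,p)` on `[0,T)` with viscosity `ν`, Leray–Hopf on `[0,T)` and Type I in time, if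
at `x₀` (a) the one-sided Lipschitz companion `‖u(t,x)‖ − ‖u(t,y)‖ ≤ C_g·dist(y,x)/(T−t)` holds on
`B(x₀,ρ) × B(x₀,2ρ)` for `t ∈ (T₀,T)`, and (b)_ν the terminal-layer dial with the parabolic lag
«∀ ε > 0 ∃ τ ∈ (0,1] ∃ l₁ > 0 ∀ l ≤ l₁ ∀ x ∈ B(x₀,ρ), ∫_{B(x,l)}|u(T−τ²l²/ν)|² ≤ ε τ l» holds, then `u`
is backward bounded at `(T,x₀)`.  Proof: viscosity normalisation to
`isBackwardBoundedAt_of_terminalLayerDecay_unit`.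
[cite: Tao2011, footnote 3; Seregin2014, Ch. 6 Prop. 3.11 (i); Seregin2020, (2.9)] -/
theorem isBackwardBoundedAt_of_terminalLayerDecay {ν T : ℝ} (hν : 0 < ν) (hT : 0 < T)
    {u : ℝ → EuclideanSpace ℝ (Fin 3) → EuclideanSpace ℝ (Fin 3)}
    {p : ℝ → EuclideanSpace ℝ (Fin 3) → ℝ}
    (hcl : IsClassicalNSSolutionOn (Set.Ico 0 T) ν 0 u p) (hLH : IsLerayHopfOn T ν 0 (u 0) u)
    (hTI : IsTypeIBlowup u T) {x₀ : EuclideanSpace ℝ (Fin 3)} {ρ Cg T₀ : ℝ} (hρ : 0 < ρ) (hCg : 0 < Cg)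
    (hT₀ : T₀ < T)
    (hlip : ∀ t ∈ Ioo T₀ T, ∀ x ∈ ball x₀ ρ, ∀ y ∈ ball x₀ (2 * ρ),
      ‖u t x‖ - ‖u t y‖ ≤ Cg / (T - t) * dist y x)
    (hlayer : ∀ ε : ℝ, 0 < ε → ∃ τ : ℝ, 0 < τ ∧ τ ≤ 1 ∧ ∃ l₁ : ℝ, 0 < l₁ ∧
      ∀ l : ℝ, 0 < l → l ≤ l₁ → ∀ x ∈ ball x₀ ρ,
        ∫⁻ y in ball x l, ‖u (T - τ ^ 2 * l ^ 2 / ν) y‖ₑ ^ 2 ≤ ENNReal.ofReal (ε * τ * l)) :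
    IsBackwardBoundedAt u T x₀ := by
  by_contra hnotbd
  have hν0 : ν ≠ 0 := hν.ne'
  have hνi : 0 < ν⁻¹ := inv_pos.2 hν
  have hνT : 0 < ν * T := mul_pos hν hT
  -- viscosity normalisation `v(s, x) = ν⁻¹ u(s/ν, x)`, blow-up time `νT`
  set v : ℝ → EuclideanSpace ℝ (Fin 3) → EuclideanSpace ℝ (Fin 3) := timeRescale ν⁻¹ ν⁻¹ u with hv
  set pv : ℝ → EuclideanSpace ℝ (Fin 3) → ℝ := timeRescale ν⁻¹ (ν⁻¹ ^ 2) p with hpv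
  have hmaps : MapsTo (fun s => ν⁻¹ * s) (Ico 0 (ν * T)) (Ico 0 T) := by
    intro s hs
    refine ⟨mul_nonneg hνi.le hs.1, ?_⟩
    calc ν⁻¹ * s < ν⁻¹ * (ν * T) := mul_lt_mul_of_pos_left hs.2 hνi
      _ = T := by rw [← mul_assoc, inv_mul_cancel₀ hν0, one_mul]
  -- (1) classical at viscosity 1 on `[0, νT)`
  have hclv : IsClassicalNSSolutionOn (Ico 0 (ν * T)) 1 0 v pv := by
    have h := hcl.viscosityRescale_set hν0 hmaps (uniqueDiffOn_Ico 0 (ν * T))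
    rwa [timeRescale_zero_force] at h
  -- (2) Leray–Hopf on `[0, νT]`
  have hv0 : ν⁻¹ • u 0 = v 0 := by
    funext x
    simp [hv]
  have hLHv : IsLerayHopfOn (ν * T) 1 0 (v 0) v := by
    have h := hLH.viscosityRescale hνi
    have e1 : T / ν⁻¹ = ν * T := by rw [div_inv_eq_mul, mul_comm]
    rwa [e1, inv_mul_cancel₀ hν0, timeRescale_zero_force, hv0] at h
  -- (3) Type I in time, (4) not backward bounded at `(νT, x₀)`
  have hTIv : IsTypeIBlowup v (ν * T) := by
    -- Type I in time is preserved by the viscosity normalisation (constant `C/√ν`); inlined, the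
    -- standalone statement lives in `…SelfMixingDichotomyCoherentScaleExclusionNoTypeII` (other cone)
    rw [hv]
    obtain ⟨C, hrateT⟩ := hTI
    have hν0 : ν ≠ 0 := hν.ne'
    have hνi : 0 < ν⁻¹ := inv_pos.2 hν
    have e0 : ν⁻¹ * (ν * T) = T := by rw [← mul_assoc, inv_mul_cancel₀ hν0, one_mul]
    have htend : Tendsto (fun s : ℝ => ν⁻¹ * s) (𝓝[<] (ν * T)) (𝓝[<] T) := by
      refine tendsto_nhdsWithin_of_tendsto_nhds_of_eventually_within _ ?_ ?_
      · have h := ((continuous_const_mul ν⁻¹).tendsto (ν * T)).mono_left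
          (nhdsWithin_le_nhds (s := Iio (ν * T)))
        rwa [e0] at h
      · refine eventually_nhdsWithin_of_forall fun s hs => ?_
        have h := mul_lt_mul_of_pos_left (mem_Iio.1 hs) hνi
        rwa [e0] at h
    refine ⟨C / Real.sqrt ν, ?_⟩
    filter_upwards [htend.eventually hrateT, self_mem_nhdsWithin] with s hs hsT x
    have hsT' : s < ν * T := hsT
    have hpos : 0 < ν * T - s := sub_pos.2 hsT'
    have e : T - ν⁻¹ * s = ν⁻¹ * (ν * T - s) := by field_simp
    have hsq : Real.sqrt (T - ν⁻¹ * s) = (Real.sqrt ν)⁻¹ * Real.sqrt (ν * T - s) := by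
      rw [e, Real.sqrt_mul hνi.le, Real.sqrt_inv]
    have hb' := hs x
    rw [hsq] at hb'
    have hsν : 0 < Real.sqrt ν := Real.sqrt_pos.2 hν
    have hsνsq : Real.sqrt ν * Real.sqrt ν = ν := Real.mul_self_sqrt hν.le
    have hsqpos : 0 < Real.sqrt (ν * T - s) := Real.sqrt_pos.2 hpos
    rw [le_div_iff₀ (by positivity)] at hb'
    have hνinv : ν⁻¹ = (Real.sqrt ν)⁻¹ * (Real.sqrt ν)⁻¹ := by rw [← mul_inv, hsνsq]
    have key : ν⁻¹ * ‖u (ν⁻¹ * s) x‖ ≤ C / Real.sqrt ν / Real.sqrt (ν * T - s) := by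
      rw [le_div_iff₀ hsqpos]
      calc ν⁻¹ * ‖u (ν⁻¹ * s) x‖ * Real.sqrt (ν * T - s)
          = (Real.sqrt ν)⁻¹ * (‖u (ν⁻¹ * s) x‖ * ((Real.sqrt ν)⁻¹ * Real.sqrt (ν * T - s))) := by
              rw [hνinv]; ring
        _ ≤ (Real.sqrt ν)⁻¹ * C := mul_le_mul_of_nonneg_left hb' (inv_nonneg.2 hsν.le)
        _ = C / Real.sqrt ν := by rw [div_eq_inv_mul]
    rw [timeRescale_apply, norm_smul, Real.norm_eq_abs, abs_of_pos hνi]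
    exact key
  have hnotbdv : ¬ IsBackwardBoundedAt v (ν * T) x₀ := not_isBackwardBoundedAt_viscosityRescale hν hnotbd
  -- the pointwise size of `v`
  have hnormv : ∀ s x, ‖v s x‖ = ν⁻¹ * ‖u (ν⁻¹ * s) x‖ := by
    intro s x
    rw [hv, timeRescale_apply, norm_smul, Real.norm_eq_abs, abs_of_pos hνi]
  have e0 : ν⁻¹ * (ν * T) = T := by rw [← mul_assoc, inv_mul_cancel₀ hν0, one_mul]
  -- (5) class (a): the Lipschitz companion on the window `(νT₀, νT)` with the same constant
  have hT₀v : ν * T₀ < ν * T := mul_lt_mul_of_pos_left hT₀ hν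
  have hlipv : ∀ s ∈ Ioo (ν * T₀) (ν * T), ∀ x ∈ ball x₀ ρ, ∀ y ∈ ball x₀ (2 * ρ),
      ‖v s x‖ - ‖v s y‖ ≤ Cg / (ν * T - s) * dist y x := by
    intro s hs x hx y hy
    have ht : ν⁻¹ * s ∈ Ioo T₀ T := by
      constructor
      · have h := mul_lt_mul_of_pos_left hs.1 hνi
        rwa [← mul_assoc, inv_mul_cancel₀ hν0, one_mul] at h
      · have h := mul_lt_mul_of_pos_left hs.2 hνi
        rwa [e0] at h
    have h1 := hlip (ν⁻¹ * s) ht x hx y hy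
    have hpos : 0 < ν * T - s := sub_pos.2 hs.2
    have e : T - ν⁻¹ * s = ν⁻¹ * (ν * T - s) := by field_simp
    rw [hnormv s x, hnormv s y, ← mul_sub]
    calc ν⁻¹ * (‖u (ν⁻¹ * s) x‖ - ‖u (ν⁻¹ * s) y‖)
        ≤ ν⁻¹ * (Cg / (T - ν⁻¹ * s) * dist y x) := mul_le_mul_of_nonneg_left h1 hνi.le
      _ = Cg / (ν * T - s) * dist y x := by
          rw [e]
          field_simp
  -- (6) class (b): the terminal-layer dial of `v` at unit viscosity
  have hlayerv : ∀ ε : ℝ, 0 < ε → ∃ τ : ℝ, 0 < τ ∧ τ ≤ 1 ∧ ∃ l₁ : ℝ, 0 < l₁ ∧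
      ∀ l : ℝ, 0 < l → l ≤ l₁ → ∀ x ∈ ball x₀ ρ,
        ∫⁻ y in ball x l, ‖v (ν * T - τ ^ 2 * l ^ 2) y‖ₑ ^ 2 ≤ ENNReal.ofReal (ε * τ * l) := by
    intro ε hε
    obtain ⟨τ, hτ, hτ1, l₁, hl₁, hl⟩ := hlayer (ν ^ 2 * ε) (by positivity)
    refine ⟨τ, hτ, hτ1, l₁, hl₁, fun l hl0 hll x hx => ?_⟩
    have key := hl l hl0 hll x hx
    -- `v(νT − τ²l²) = ν⁻¹ u(T − τ²l²/ν)`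
    have e1 : ν⁻¹ * (ν * T - τ ^ 2 * l ^ 2) = T - τ ^ 2 * l ^ 2 / ν := by field_simp
    have e2 : (fun y => ‖v (ν * T - τ ^ 2 * l ^ 2) y‖ₑ ^ 2) =
        fun y => ‖ν⁻¹ • u (T - τ ^ 2 * l ^ 2 / ν) y‖ₑ ^ 2 := by
      funext y
      rw [hv, timeRescale_apply, e1]
    rw [e2, lintegral_enorm_sq_const_smul]
    calc ENNReal.ofReal (ν⁻¹ ^ 2) * ∫⁻ y in ball x l, ‖u (T - τ ^ 2 * l ^ 2 / ν) y‖ₑ ^ 2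
        ≤ ENNReal.ofReal (ν⁻¹ ^ 2) * ENNReal.ofReal (ν ^ 2 * ε * τ * l) := by gcongr
      _ = ENNReal.ofReal (ε * τ * l) := by
          rw [← ENNReal.ofReal_mul (by positivity)]
          congr 1
          field_simp
  exact hnotbdv (isBackwardBoundedAt_of_terminalLayerDecay_unit hνT hclv hLHv hTIv hρ hCg hT₀v hlipv hlayerv)

/-- **`TypeITraceScarL3` in the class «terminal-layer energy below `√σ`», EVERY viscosity** (item
18385's binders VERBATIM + class (a) ∧ (b)_ν at `x₀` ⇒ the item's conclusion at `x₀`, vacuously: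
`(T,x₀)` is then not backward singular).  (a) = the one-sided Lipschitz companion
`‖u(t,x)‖ − ‖u(t,y)‖ ≤ C_g·dist(y,x)/(T−t)` on `B(x₀,ρ) × B(x₀,2ρ)`, `t ∈ (T₀,T)`; (b)_ν = the dial with
the parabolic lag, «∀ ε > 0 ∃ τ ∈ (0,1] ∃ l₁ > 0 ∀ l ≤ l₁ ∀ x ∈ B(x₀,ρ), ∫_{B(x,l)}|u(T−τ²l²/ν)|² ≤ ε τ l».
No pressure clause, no carried hypothesis; ν-general twin of `typeITraceScarL3_unitViscosity_of_layerDecay`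
(nsreg-p2 g30, plate t34).  [cite: Tao2011, footnote 3; Seregin2014, Ch. 6 Prop. 3.11 (i); Seregin2020, (2.9)] -/
theorem typeITraceScarL3_of_terminalLayerDecay :
    ∀ (ν T : ℝ), 0 < ν → 0 < T →
    ∀ (u : ℝ → EuclideanSpace ℝ (Fin 3) → EuclideanSpace ℝ (Fin 3)) (p : ℝ → EuclideanSpace ℝ (Fin 3) → ℝ),
      IsClassicalNSSolutionOn (Set.Ico 0 T) ν 0 u p →
      IsLerayHopfOn T ν 0 (u 0) u →
      HasRapidSpatialDecay (u 0) →
      IsTypeIBlowup u T →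
      ∀ x₀ : EuclideanSpace ℝ (Fin 3),
        -- the class (a) + (b)_ν at `x₀`
        (∃ ρ Cg T₀ : ℝ, 0 < ρ ∧ 0 < Cg ∧ T₀ < T ∧
          (∀ t ∈ Ioo T₀ T, ∀ x ∈ ball x₀ ρ, ∀ y ∈ ball x₀ (2 * ρ),
            ‖u t x‖ - ‖u t y‖ ≤ Cg / (T - t) * dist y x) ∧
          (∀ ε : ℝ, 0 < ε → ∃ τ : ℝ, 0 < τ ∧ τ ≤ 1 ∧ ∃ l₁ : ℝ, 0 < l₁ ∧
            ∀ l : ℝ, 0 < l → l ≤ l₁ → ∀ x ∈ ball x₀ ρ,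
              ∫⁻ y in ball x l, ‖u (T - τ ^ 2 * l ^ 2 / ν) y‖ₑ ^ 2 ≤ ENNReal.ofReal (ε * τ * l))) →
        (∀ r : ℝ, 0 < r → eLpNorm (Function.uncurry u) ⊤
          (volume.restrict (parabolicCylinder r (T, x₀))) = ⊤) →
        ∀ ρ' : ℝ, 0 < ρ' → ¬ MemLp (u T) 3 (volume.restrict (ball x₀ ρ')) := by
  intro ν T hν hT u p hcl hLH _hdec hTI x₀ hclass hsing ρ' _hρ' _hL3
  obtain ⟨ρ, Cg, T₀, hρ, hCg, hT₀, hlip, hlayer⟩ := hclass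
  exact not_isBackwardBoundedAt_of_forall_eLpNorm_top hsing
    (isBackwardBoundedAt_of_terminalLayerDecay hν hT hcl hLH hTI hρ hCg hT₀ hlip hlayer)


end Summit.NavierStokesRegularity.NavierStokesRegularity.Theorems.TypeITraceScarL3

end
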